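import Summits.AnomalousDissipation.AnomalousDissipation.Theses.FrictionOrderLadder

/-!
# Crux `CleanRoomInjectionFloor` (stmt-AnomalousDissipation-2932, route FrictionOrderLadder, rank 2) — birth skeleton

`Lines/birth.lean` (BC3): three NAMED stubs and the kernel-checked composition
`CleanRoomInjectionFloor_of : stub₁ → stub₂ → stub₃ → CleanRoomInjectionFloor` concluding the route decl
`Summit.AnomalousDissipation.AnomalousDissipation.Theses.FrictionOrderLadder.CleanRoomInjectionFloor` BY NAME
(hypotheses = the name-keyed aliases `__Registered.stub_*`, textually the stub signatures; sorries only
inside the three `stub_*`; wiring `example` at the end).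

## The crux

`CleanRoomInjectionFloor` (friction-robust zeroth law in Lions' clean room, INJECTION form): there are a
smooth steady divergence-free mean-zero force `f`, viscosities `ν_j → 0⁺`, smooth divergence-free
mean-zero data `u₀ j` and constants `μ₀, ε > 0`, `E`, `T₀` such that for every `j` and EVERY
hyperviscosity `μ ∈ (0, μ₀]` SOME global classical solution `(u, p)` of the clean-room system
`∂ₜu + (u·∇)u + ∇p = ν_jΔu − μΔ²u + f`, `u 0 = u₀ j` (typed `Torus.IsClassicalNSSolutionOn (Ici 0) (ν j)`
with `−μ·fracLaplacian 2 (u t)` in the force slot) has running means `T⁻¹∫₀ᵀ‖u‖₂² ≤ E` and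
`T⁻¹∫₀ᵀ(f, u) ≥ ε` for all `T ≥ T₀`.

## The cut: EXISTENCE (known) ∣ ENERGY BUDGET (known-type) ∣ A-PRIORI FRICTION FLOOR (the residue)

The classical PDE split "construction of the solution" / "a-priori estimates valid for EVERY smooth
solution", plus the Doering–Foias budget that converts a floor on TOTAL FRICTION DISSIPATION into the
crux's floor on INJECTION:

* `stub_cleanRoomWellPosed` (known, not yet in tree; size L): for `ν, μ > 0`, smooth steady admissible
  `f` and smooth admissible `u₀` the clean-room system has a GLOBAL classical solution on `T³ × [0, ∞)`
  from `u₀` (Beirão da Veiga 1985 = Lemarié-Rieusset 2016 Thm 18.5 on `ℝ³`, same proof on `T³`; Lions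
  1969 Rem 6.11: order `2 ≥ 5/4`; Temam 1997 VIII (4.6)). The grounder's "FACT WANTED: clean-room global
  well-posedness on T³" (note on the item, 2026-08-15) is exactly this stub.
* `stub_cleanRoomBudget` (known-type, provable now; size M): for every classical clean-room solution on
  `[0, ∞)` and every `T > 0`,
  `timeMean (f,u) T = timeMean (ν‖∇u‖² + μ∫⟪u, Δ²u⟫) T + (KE(u T) − KE(u 0))/T` — the energy balance
  `IsClassicalNSSolutionOn.energy_balance_holds` (in tree) with the hyperviscous term read out of the
  force slot, integrated over `[0, T]` (one-sided FTC) and divided by `T` (Doering–Foias 2002 §2 (2.4)–(2.6)).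
* `stub_aprioriFrictionFloor` (the residue; open, zeroth-law class; size XL): there are admissible `f`,
  `ν_j → 0⁺`, admissible data `u₀ j` of kinetic energy `≤ K`, and `μ₀, δ > 0`, `E`, `T₀` such that for
  every `j`, every `μ ∈ (0, μ₀]` and EVERY global classical clean-room solution from `u₀ j`:
  `timeMean ‖u‖₂² ≤ E` and `timeMean (ν_j‖∇u‖² + μ∫⟪u, Δ²u⟫) ≥ δ` for all `T ≥ T₀` — the friction-robust
  zeroth law in its A-PRIORI, DISSIPATION form: a statement about all smooth solutions of a globally
  well-posed system (uniqueness holds for `μ > 0`, so nothing is lost), which is the shape every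
  energy-method / background-flow / auxiliary-functional (SOS) technique actually outputs
  (DoeringFoias2002 §2–3; ChernyshenkoEtAl2014; TobascoGoluskinDoering2018: bounds on `timeMean Φ` over ALL
  trajectories of the form `Φ̄_T ≥ δ − C/T`). Why it might fail = why the crux might: no `ν`-uniform
  dissipation floor nor `ν`-uniform energy bound is known for ANY deterministic friction (Doering–Foias:
  upper bounds only; Cheskidov2023 p.4: no example), shear/gravest-mode forces laminarise (energy `~ν⁻²`).

Composition (`CleanRoomInjectionFloor_of`, no sorry): take the data of stub 3; `ε := δ/2`,
`T₀' := max T₀ (max 1 (2K/δ))`; for `j`, `μ ∈ (0, μ₀]` the solution `(u, p)` is stub 1's; the energy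
clause is stub 3's verbatim; for the injection clause rewrite with stub 2 and bound
`(KE(u T) − KE(u 0))/T ≥ −K/T ≥ −δ/2` (`KE ≥ 0`, `u 0 = u₀ j`, `KE(u₀ j) ≤ K`, `T ≥ 2K/δ`), so
`timeMean (f,u) T ≥ δ − δ/2 = ε`.

Disproof used: none relevant — `ledger crux ls stmt-AnomalousDissipation-2932`: no workfiles (no
`Disproof.lean`, no `Theorems/CleanRoomInjectionFloor/Negative/*`) at registration. Negatives index: the
two universal-over-data energy statements refuted by Galilean drift of non-zero-mean data
(FrustratedForces.GPEnergyCeiling, stmt-2979; Correlation.EnergyUnboundedNeg, stmt-0204) are honoured —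
stub 3 is witness-type in `f` and in the MEAN-ZERO data `u₀ j`, universal only over the solutions from
those data, and its energy ceiling is part of the witness claim, never asserted over all data.

Hardest stub: `stub_aprioriFrictionFloor` (it is the crux's open content). Stubs 1–2 lean on
`Literature.Analysis.FunctionSpaces.Torus.IsClassicalNSSolutionOn(.energy_balance_holds)`,
`Literature.Analysis.FluidPDE.Torus.{continuousOn_integral_inner_fracLaplacian,
integral_inner_self_fracLaplacian_nonneg, integral_inner_fracLaplacian_comm, isSmoothSpaceTimeOn_fracLaplacian}`,
`intervalIntegral.integral_eq_sub_of_hasDeriv_right_of_le`, and the Galerkin/Leray–Hopf templates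
`FracNSGalerkin*`, `TorusClassicalLerayHopf*` for the construction.
-/

-- `Summit.<Summit>.<Problem>`: single-conjunct summit, the duplicate component is the tree's convention.
set_option linter.dupNamespace false

noncomputable section

open Filter Set MeasureTheory Topology

namespace Summit.AnomalousDissipation.AnomalousDissipation.Cruxes.CleanRoomInjectionFloor.Birth

/-- **stub 1 — GLOBAL CLASSICAL WELL-POSEDNESS OF LIONS' CLEAN ROOM ON `T³` (known, not in tree; size L).**
For `ν > 0`, `μ > 0`, a smooth steady divergence-free mean-zero force `f` and a smooth divergence-free
mean-zero datum `u₀`, the hyperviscous Navier–Stokes system `∂ₜu + (u·∇)u + ∇p = νΔu − μΔ²u + f`,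
`div u = 0`, has a GLOBAL classical solution `(u, p)` on `T³ × [0, ∞)` with `u 0 = u₀` (typed exactly as
in the crux: `Torus.IsClassicalNSSolutionOn (Ici 0) ν` with `−μ·fracLaplacian 2 (u t)` carried in the
force slot). Why true: the dissipation order `2` exceeds Lions' critical exponent `5/4`, so the energy
estimate `sup_t‖u‖₂² + μ∫‖Δu‖₂² < ∞` is subcritical and the Galerkin/energy method closes at every level
of regularity (Lions1969 Rem 6.11; BeiraoDaVeiga1985 = LemarieRieusset2016 §18.3 Thm 18.5: unique global
solution of NS + `αΔ²` for `α > 0`, proof on `ℝ³`, verbatim on `T³`; Temam1997 Ch. VIII §4.2 (4.6));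
smoothness up to `t = 0` holds on the boundaryless torus (no compatibility conditions; all
`∂ₜᵏu(0)` are read off the equation), joint `C^∞` by parabolic bootstrapping; the mean-zero pressure is
smooth. Why it might fail: it should not — the Lean cost is the construction (Galerkin scheme
`FracNSGalerkin*` templates, compactness, higher-energy estimates, parabolic smoothing to `C^∞` jointly in
`(t, x)` INCLUDING `t = 0⁺`). Sources: BeiraoDaVeiga1985, LemarieRieusset2016, Lions1969, Temam1997,
MattinglySinai1999. -/
theorem stub_cleanRoomWellPosed :
    ∀ (ν μ : ℝ) (f u₀ : UnitAddTorus (Fin 3) → EuclideanSpace ℝ (Fin 3)), 0 < ν → 0 < μ → Literature.Analysis.FunctionSpaces.Torus.IsSmooth f → Literature.Analysis.FunctionSpaces.Torus.IsDivFree f → Literature.Analysis.FunctionSpaces.Torus.HasZeroMean f → Literature.Analysis.FunctionSpaces.Torus.IsSmooth u₀ → Literature.Analysis.FunctionSpaces.Torus.IsDivFree u₀ → Literature.Analysis.FunctionSpaces.Torus.HasZeroMean u₀ → ∃ (u : ℝ → UnitAddTorus (Fin 3) → EuclideanSpace ℝ (Fin 3)) (p : ℝ → UnitAddTorus (Fin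 3) → ℝ), Literature.Analysis.FunctionSpaces.Torus.IsClassicalNSSolutionOn (Set.Ici 0) ν (fun t x => f x - μ • Literature.Analysis.FluidPDE.Torus.fracLaplacian (2 : ℝ) (u t) x) u p ∧ u 0 = u₀ := by
  sorry

/-- **stub 2 — THE CLEAN-ROOM ENERGY BUDGET IN RUNNING-MEAN FORM (known-type, provable now; size M).**
For every classical solution `(u, p)` on `[0, ∞)` of the clean-room system with smooth steady force `f`,
viscosity `ν` and hyperviscosity `μ` (any reals) and every `T > 0`:
`timeMean (f,u) T = timeMean (ν·gradNormSq u + μ·∫⟪u, (−Δ)²u⟫) T + (kineticEnergy (u T) − kineticEnergy (u 0)) / T`.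
Why true: `IsClassicalNSSolutionOn.energy_balance_holds` (in tree; Doering–Foias 2002 §2 (2.4)) gives
`d/dt ½‖u‖₂² = −ν‖∇u‖₂² + ∫⟪f − μ(−Δ)²u, u⟫` within `Ici 0`; split the force pairing by linearity
(both summands integrable: `f`, `u t`, `fracLaplacian 2 (u t)` continuous on the compact torus —
`integrable_fracLaplacian`), integrate over `[0, T]` by the one-sided FTC
(`intervalIntegral.integral_eq_sub_of_hasDeriv_right_of_le`; the integrands are continuous in `t`:
`continuousOn_integral_inner_fracLaplacian`, joint smoothness for `gradNormSq` and `(f, u)`), divide by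
`T` and unfold `timeMean g T = T⁻¹∫₀ᵀ g`. Why it might fail: it should not; the Lean work is the
time-continuity of `t ↦ gradNormSq (u t)` from `IsSmoothSpaceTimeOn` and the interval-integrability
bookkeeping. Sources: DoeringFoias2002, Temam1997. -/
theorem stub_cleanRoomBudget :
    ∀ (ν μ : ℝ) (f : UnitAddTorus (Fin 3) → EuclideanSpace ℝ (Fin 3)) (u : ℝ → UnitAddTorus (Fin 3) → EuclideanSpace ℝ (Fin 3)) (p : ℝ → UnitAddTorus (Fin 3) → ℝ), Literature.Analysis.FunctionSpaces.Torus.IsSmooth f → Literature.Analysis.FunctionSpaces.Torus.IsClassicalNSSolutionOn (Set.Ici 0) ν (fun t x => f x - μ • Literature.Analysis.FluidPDE.Torus.fracLaplacian (2 : ℝ) (u t) x) u p → ∀ T : ℝ, 0 < T → Literature.Analysis.FluidPDE.timeMean (fun t => MeasureTheory.integral MeasureTheory.volume (fun x => inner ℝ (f x) (u t x))) T = Literature.Analysis.FluidPDE.timeMean (fun t => ν * Literature.Analysis.FunctionSpaces.Torus.gradNormSq (u t) + μ * MeasureTheory.integral MeasureTheory.volume (fun x => inner ℝ (u t x) (Literature.Analysis.FluidPDE.Torus.fracLaplacian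 (2 : ℝ) (u t) x))) T + (Literature.Analysis.FunctionSpaces.Torus.kineticEnergy (u T) - Literature.Analysis.FunctionSpaces.Torus.kineticEnergy (u 0)) / T := by
  sorry

/-- **stub 3 — A-PRIORI FRICTION-ROBUST DISSIPATION FLOOR (the residue of the crux; open, zeroth-law
class; size XL).** There are a smooth steady divergence-free mean-zero force `f` on `T³`, viscosities
`ν_j > 0`, `ν_j → 0`, smooth divergence-free mean-zero data `u₀ j` with `kineticEnergy (u₀ j) ≤ K`, and
constants `μ₀, δ > 0`, `E`, `T₀` such that for every `j`, every hyperviscosity `μ ∈ (0, μ₀]` and EVERY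
global classical solution `(u, p)` of the clean-room system `∂ₜu + (u·∇)u + ∇p = ν_jΔu − μΔ²u + f` with
`u 0 = u₀ j`, for all `T ≥ T₀`: the running-mean energy `T⁻¹∫₀ᵀ‖u‖₂² ≤ E` and the running-mean TOTAL
friction dissipation `T⁻¹∫₀ᵀ (ν_j‖∇u‖₂² + μ∫⟪u, (−Δ)²u⟫) ≥ δ`. This is the crux in A-PRIORI (all
solutions from the chosen data — for `μ > 0` the classical solution is unique, so nothing is lost) and
DISSIPATION form (inside the clean room injection and total friction dissipation have the same running
means up to `(KE(u T) − KE(u 0))/T`, stub 2): the shape in which energy / background-flow /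
auxiliary-functional (SOS) methods deliver bounds on time averages over ALL trajectories
(DoeringFoias2002 §2–3, ChernyshenkoEtAl2014, TobascoGoluskinDoering2018), uniform in the two friction
parameters. The floor is deliberately on the TOTAL friction dissipation, not on the viscous share
(physically false for `μ ≫ ν^{11/8}`, where hyperviscosity absorbs the cascade first). Why it might fail:
it IS the friction-robust zeroth law — no `ν`-uniform dissipation floor nor `ν`-uniform mean-energy
bound is known for ANY deterministic friction (Doering–Foias: upper bounds `ε ≤ C U³/ℓ` only;
Cheskidov2023 p.4: no example saturating them; BrueDeLellis2023 Q2.1–2.2 open); shear / gravest-mode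
forces laminarise with energy `~ν⁻²`, so `f` and the data must avoid invariant laminar subspaces;
transients may last `~1/ν`, threatening a `j`-uniform `T₀`. Negatives honoured: the energy ceiling is
claimed only for the solutions from the chosen MEAN-ZERO data (GPEnergyCeiling stmt-2979 and
EnergyUnboundedNeg stmt-0204 died by Galilean drift of arbitrary data). Sources: DoeringFoias2002,
Cheskidov2023, BrueDeLellis2023, BorueOrszag1996, HaugenBrandenburg2004, AgrawalEtAl2020, KanedaEtAl2003,
ChernyshenkoEtAl2014, TobascoGoluskinDoering2018. -/
theorem stub_aprioriFrictionFloor :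
    ∃ f : UnitAddTorus (Fin 3) → EuclideanSpace ℝ (Fin 3), Literature.Analysis.FunctionSpaces.Torus.IsSmooth f ∧ Literature.Analysis.FunctionSpaces.Torus.IsDivFree f ∧ Literature.Analysis.FunctionSpaces.Torus.HasZeroMean f ∧ ∃ (ν : ℕ → ℝ) (u₀ : ℕ → UnitAddTorus (Fin 3) → EuclideanSpace ℝ (Fin 3)), (∀ j, 0 < ν j) ∧ Filter.Tendsto ν Filter.atTop (nhds 0) ∧ (∀ j, Literature.Analysis.FunctionSpaces.Torus.IsSmooth (u₀ j) ∧ Literature.Analysis.FunctionSpaces.Torus.IsDivFree (u₀ j) ∧ Literature.Analysis.FunctionSpaces.Torus.HasZeroMean (u₀ j)) ∧ ∃ μ₀ K E δ T₀ : ℝ, 0 < μ₀ ∧ 0 < δ ∧ (∀ j, Literature.Analysis.FunctionSpaces.Torus.kineticEnergy (u₀ j) ≤ K) ∧ ∀ (j : ℕ) (μ : ℝ), 0 < μ → μ ≤ μ₀ → ∀ (u : ℝ → UnitAddTorus (Fin 3) → EuclideanSpace ℝ (Fin 3)) (p : ℝ → UnitAddTorus (Fin 3) → ℝ), Literature.Analysis.FunctionSpaces.Torus.IsClassicalNSSolutionOn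 (Set.Ici 0) (ν j) (fun t x => f x - μ • Literature.Analysis.FluidPDE.Torus.fracLaplacian (2 : ℝ) (u t) x) u p → u 0 = u₀ j → ∀ T : ℝ, T₀ ≤ T → Literature.Analysis.FluidPDE.timeMean (fun t => MeasureTheory.integral MeasureTheory.volume (fun x => ‖u t x‖ ^ 2)) T ≤ E ∧ δ ≤ Literature.Analysis.FluidPDE.timeMean (fun t => ν j * Literature.Analysis.FunctionSpaces.Torus.gradNormSq (u t) + μ * MeasureTheory.integral MeasureTheory.volume (fun x => inner ℝ (u t x) (Literature.Analysis.FluidPDE.Torus.fracLaplacian (2 : ℝ) (u t) x))) T := by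
  sorry

/-! ## Name-keyed aliases of the three stub statements — the hypotheses of `CleanRoomInjectionFloor_of`

The native skeleton audit (`#h21_check_skeleton`, run by `ledger skeleton check`) admits a hypothesis of
the composing theorem only if its head constant is a registered obligation or is NAMED like a declared
stub; `__Registered.stub_X` is the statement of `stub_X` verbatim under the stub's short name (device of
`Cruxes/RecurrentDebris/Lines/birth.lean`, `Cruxes/CyclicWindLineLoud/Lines/birth.lean`). Each alias is
an `abbrev`, textually its stub's signature. -/
namespace __Registered

/-- Alias of the statement of `stub_cleanRoomWellPosed` (global classical well-posedness of the clean room), keyed by the stub name. -/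
abbrev stub_cleanRoomWellPosed : Prop :=
  ∀ (ν μ : ℝ) (f u₀ : UnitAddTorus (Fin 3) → EuclideanSpace ℝ (Fin 3)), 0 < ν → 0 < μ → Literature.Analysis.FunctionSpaces.Torus.IsSmooth f → Literature.Analysis.FunctionSpaces.Torus.IsDivFree f → Literature.Analysis.FunctionSpaces.Torus.HasZeroMean f → Literature.Analysis.FunctionSpaces.Torus.IsSmooth u₀ → Literature.Analysis.FunctionSpaces.Torus.IsDivFree u₀ → Literature.Analysis.FunctionSpaces.Torus.HasZeroMean u₀ → ∃ (u : ℝ → UnitAddTorus (Fin 3) → EuclideanSpace ℝ (Fin 3)) (p : ℝ → UnitAddTorus (Fin 3) → ℝ), Literature.Analysis.FunctionSpaces.Torus.IsClassicalNSSolutionOn (Set.Ici 0) ν (fun t x => f x - μ • Literature.Analysis.FluidPDE.Torus.fracLaplacian (2 : ℝ) (u t) x) u p ∧ u 0 = u₀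

/-- Alias of the statement of `stub_cleanRoomBudget` (running-mean energy budget), keyed by the stub name. -/
abbrev stub_cleanRoomBudget : Prop :=
  ∀ (ν μ : ℝ) (f : UnitAddTorus (Fin 3) → EuclideanSpace ℝ (Fin 3)) (u : ℝ → UnitAddTorus (Fin 3) → EuclideanSpace ℝ (Fin 3)) (p : ℝ → UnitAddTorus (Fin 3) → ℝ), Literature.Analysis.FunctionSpaces.Torus.IsSmooth f → Literature.Analysis.FunctionSpaces.Torus.IsClassicalNSSolutionOn (Set.Ici 0) ν (fun t x => f x - μ • Literature.Analysis.FluidPDE.Torus.fracLaplacian (2 : ℝ) (u t) x) u p → ∀ T : ℝ, 0 < T → Literature.Analysis.FluidPDE.timeMean (fun t => MeasureTheory.integral MeasureTheory.volume (fun x => inner ℝ (f x) (u t x))) T = Literature.Analysis.FluidPDE.timeMean (fun t => ν * Literature.Analysis.FunctionSpaces.Torus.gradNormSq (u t) + μ * MeasureTheory.integral MeasureTheory.volume (fun x => inner ℝ (u t x) (Literature.Analysis.FluidPDE.Torus.fracLaplacian (2 : ℝ) (u t) x))) T + (Literature.Analysis.FunctionSpaces.Torus.kineticEnergy (u T) -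 Literature.Analysis.FunctionSpaces.Torus.kineticEnergy (u 0)) / T

/-- Alias of the statement of `stub_aprioriFrictionFloor` (a-priori friction-robust dissipation floor), keyed by the stub name. -/
abbrev stub_aprioriFrictionFloor : Prop :=
  ∃ f : UnitAddTorus (Fin 3) → EuclideanSpace ℝ (Fin 3), Literature.Analysis.FunctionSpaces.Torus.IsSmooth f ∧ Literature.Analysis.FunctionSpaces.Torus.IsDivFree f ∧ Literature.Analysis.FunctionSpaces.Torus.HasZeroMean f ∧ ∃ (ν : ℕ → ℝ) (u₀ : ℕ → UnitAddTorus (Fin 3) → EuclideanSpace ℝ (Fin 3)), (∀ j, 0 < ν j) ∧ Filter.Tendsto ν Filter.atTop (nhds 0) ∧ (∀ j, Literature.Analysis.FunctionSpaces.Torus.IsSmooth (u₀ j) ∧ Literature.Analysis.FunctionSpaces.Torus.IsDivFree (u₀ j) ∧ Literature.Analysis.FunctionSpaces.Torus.HasZeroMean (u₀ j)) ∧ ∃ μ₀ K E δ T₀ : ℝ, 0 < μ₀ ∧ 0 < δ ∧ (∀ j, Literature.Analysis.FunctionSpaces.Torus.kineticEnergy (u₀ j) ≤ K) ∧ ∀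 (j : ℕ) (μ : ℝ), 0 < μ → μ ≤ μ₀ → ∀ (u : ℝ → UnitAddTorus (Fin 3) → EuclideanSpace ℝ (Fin 3)) (p : ℝ → UnitAddTorus (Fin 3) → ℝ), Literature.Analysis.FunctionSpaces.Torus.IsClassicalNSSolutionOn (Set.Ici 0) (ν j) (fun t x => f x - μ • Literature.Analysis.FluidPDE.Torus.fracLaplacian (2 : ℝ) (u t) x) u p → u 0 = u₀ j → ∀ T : ℝ, T₀ ≤ T → Literature.Analysis.FluidPDE.timeMean (fun t => MeasureTheory.integral MeasureTheory.volume (fun x => ‖u t x‖ ^ 2)) T ≤ E ∧ δ ≤ Literature.Analysis.FluidPDE.timeMean (fun t => ν j * Literature.Analysis.FunctionSpaces.Torus.gradNormSq (u t) + μ * MeasureTheory.integral MeasureTheory.volume (fun x => inner ℝ (u t x) (Literature.Analysis.FluidPDE.Torus.fracLaplacian (2 : ℝ) (u t) x))) T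

end __Registered

/-- **Composition** (kernel-checked, no `sorry` of its own): the three stub statements (as the
name-keyed aliases `__Registered.stub_*`) imply the crux
`Summit.AnomalousDissipation.AnomalousDissipation.Theses.FrictionOrderLadder.CleanRoomInjectionFloor` BY
NAME. Witnesses: stub 3's `f, ν, u₀, μ₀, E`, with `ε := δ/2` and `T₀' := max T₀ (max 1 (2K/δ))`; the
solution for `(j, μ)` is stub 1's; the injection floor is stub 3's dissipation floor moved through the
budget of stub 2, the energy drop being `≥ −K/T ≥ −δ/2` for `T ≥ 2K/δ` (Doering–Foias 2002 §2).
[bookkeeping] -/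
theorem CleanRoomInjectionFloor_of :
    __Registered.stub_cleanRoomWellPosed → __Registered.stub_cleanRoomBudget →
      __Registered.stub_aprioriFrictionFloor →
        Summit.AnomalousDissipation.AnomalousDissipation.Theses.FrictionOrderLadder.CleanRoomInjectionFloor := by
  intro hWP hB hF
  dsimp only [__Registered.stub_cleanRoomWellPosed, __Registered.stub_cleanRoomBudget,
    __Registered.stub_aprioriFrictionFloor] at hWP hB hF
  obtain ⟨f, hf, hdf, hmf, ν, u₀, hν, hν0, hu₀, μ₀, K, E, δ, T₀, hμ₀, hδ, hK, H⟩ := hF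
  unfold Summit.AnomalousDissipation.AnomalousDissipation.Theses.FrictionOrderLadder.CleanRoomInjectionFloor
  refine ⟨f, hf, hdf, hmf, ν, u₀, hν, hν0, hu₀, μ₀, E, δ / 2, max T₀ (max 1 (2 * K / δ)), hμ₀,
    half_pos hδ, ?_⟩
  intro j μ hμ hμle
  -- the solution: stub 1 (global classical well-posedness of the clean room)
  obtain ⟨u, p, hsol, hu0⟩ :=
    hWP (ν j) μ f (u₀ j) (hν j) hμ hf hdf hmf (hu₀ j).1 (hu₀ j).2.1 (hu₀ j).2.2
  refine ⟨u, p, hsol, hu0, ?_⟩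
  intro T hT
  have hT₀ : T₀ ≤ T := le_trans (le_max_left _ _) hT
  have hT1 : (1 : ℝ) ≤ T := le_trans (le_trans (le_max_left _ _) (le_max_right _ _)) hT
  have hTK : 2 * K / δ ≤ T := le_trans (le_trans (le_max_right _ _) (le_max_right _ _)) hT
  have hTpos : 0 < T := lt_of_lt_of_le one_pos hT1
  -- the a-priori bounds: stub 3, for this solution
  obtain ⟨hE, hD⟩ := H j μ hμ hμle u p hsol hu0 T hT₀
  refine ⟨hE, ?_⟩
  -- injection = total friction dissipation + energy drop / T: stub 2
  rw [hB (ν j) μ f u p hf hsol T hTpos]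
  have hKE_T : 0 ≤ Literature.Analysis.FunctionSpaces.Torus.kineticEnergy (u T) :=
    Literature.Analysis.FunctionSpaces.Torus.kineticEnergy_nonneg _
  have hKE_0 : Literature.Analysis.FunctionSpaces.Torus.kineticEnergy (u 0) ≤ K := by
    rw [hu0]; exact hK j
  have h2K : 2 * K ≤ T * δ := (div_le_iff₀ hδ).mp hTK
  have hdrop : -(δ / 2) ≤ (Literature.Analysis.FunctionSpaces.Torus.kineticEnergy (u T) -
      Literature.Analysis.FunctionSpaces.Torus.kineticEnergy (u 0)) / T := by
    rw [le_div_iff₀ hTpos]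
    nlinarith [hKE_T, hKE_0, h2K, hTpos.le, hδ.le]
  linarith [hD, hdrop]

/-- WIRING CHECK: the three sorried stubs compose to a closed term of the crux's type (modulo their
`sorry`s). Deliberately an `example` (no constant enters the environment). -/
example : Summit.AnomalousDissipation.AnomalousDissipation.Theses.FrictionOrderLadder.CleanRoomInjectionFloor :=
  CleanRoomInjectionFloor_of stub_cleanRoomWellPosed stub_cleanRoomBudget stub_aprioriFrictionFloor

end Summit.AnomalousDissipation.AnomalousDissipation.Cruxes.CleanRoomInjectionFloor.Birth

end
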